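import Mathlib
import Summits.ResolutionOfSingularities.ResolutionOfSingularities.Theorems.FrobeniusClosingSteerCotangentQuadratic
import Summits.ResolutionOfSingularities.ResolutionOfSingularities.Theorems.FrobeniusClosingSteerQuadraticStepLemmas

/-!
# B7 `rankFour_exit_two`, point-step case I: the `δ`-span lemma along a quadratic transform
# (chain W4.1, crux `Steer`, σ-residual LOW half)

OURS (campaign res-hironaka, rung L, slot W4.1; helper for crux `Steer` stmt-ResolutionOfSingularities-16345;
res-L0-w41-strat-2's one-step lemma B7, STRAT2-MEMO-1 §4b). NOT a statement of any manuscript; nothing here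
is attributed to [claim: Hironaka2017, status: under-review]. AI-written; weaker than expert review.

Setting (characteristic `2`): `R ⊂ R₁` a quadratic transform along a valuation ring `O` of `K`
(`IsQuadraticTransformAlong`, `R` dominated by `O`, residues of `R` squares), chart generator `x₀`, and an
additive map `δ : R₁ → 𝔪₁/𝔪₁²` with Leibniz rule killing squares (the cotangent derivation of
`CotangentDerivation.exists_cotangentDerivation`).
* `delta_inclusion_mem_span` — `δ` of an OLD element `a ∈ R` is a multiple of `δ x₀`
  (`a = b² + x₀ · (m/x₀)`);
* `span_delta_eq_top` — for lifts `u` of a spanning family of `𝔪_R/𝔪_R²`, the classes `δ x₀` and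
  `δ (u_j/x₀)` SPAN `𝔪₁/𝔪₁²` (closure induction over the chart ring `R[𝔪/x₀]`, then fractions with unit
  denominators; `δ` restricted to `𝔪₁` is onto). No rationality of the blown-up point is needed.
[folklore]
-/

noncomputable section

-- `Summit.<S>.<S>.…` duplicates the summit name by design (single-problem summit).
set_option linter.dupNamespace false

namespace Summit.ResolutionOfSingularities.ResolutionOfSingularities.Theorems.SwitchingDichotomy.RankFourExit

open IsLocalRing Module Literature.AlgebraicGeometry.Resolution
open Summit.ResolutionOfSingularities.ResolutionOfSingularities.Theorems.SwitchingDichotomy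

-- `K : Type` (universe `0`) as in the skeleton of record and the quadratic-step lemmas it consumes.
variable {K : Type} [Field K]

/-! ## The `δ`-span lemma along a quadratic transform -/

/-- Characteristic `2`: a local subring of `K` whose residues are squares has a residue field of
characteristic `2` (bookkeeping). [folklore] -/
theorem charP_residueField_two [CharP K 2] (S : Subring K) [IsLocalRing S] : CharP (ResidueField S) 2 := by
  have h0 : ((2 : ℕ) : ResidueField S) = 0 := by
    have : ((2 : ℕ) : S) = 0 := CharP.cast_eq_zero S 2
    rw [← map_natCast (residue S), this, map_zero]
  exact (CharP.charP_iff_prime_eq_zero Nat.prime_two).mpr h0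

/-- **`δ` of an OLD element is a multiple of `δ x₀`.** Along the quadratic transform `R ⊂ R₁` with chart
generator `x₀`, for `a ∈ R` write `a = b² + m` (`m ∈ 𝔪_R`, residues of `R` are squares) and `m = x₀ · (m/x₀)`
with `m/x₀ ∈ R₁`; then `δ(a) = (m/x₀)‾ · δ(x₀)`. [folklore] -/
theorem delta_inclusion_mem_span [CharP K 2] {O : ValuationSubring K} {R R₁ : Subring K}
    [IsLocalRing R] [IsLocalRing R₁] (hQT : IsQuadraticTransformAlong O R R₁)
    (hdom : SubringDominates R O.toSubring)
    (hperf : ∀ a : R, ∃ b : R, a - b ^ 2 ∈ maximalIdeal R)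
    (x₀ : R) (hx₀m : x₀ ∈ maximalIdeal R) (hx₀0 : x₀ ≠ 0)
    (hx₀max : ∀ y ∈ maximalIdeal R, O.valuation (y : K) ≤ O.valuation (x₀ : K))
    (x₀' : R₁) (hx₀' : (x₀' : K) = x₀)
    (δ : R₁ → CotangentSpace R₁)
    (hδadd : ∀ a b : R₁, δ (a + b) = δ a + δ b)
    (hδmul : ∀ a b : R₁, δ (a * b) = residue R₁ a • δ b + residue R₁ b • δ a)
    (hδsq : ∀ b : R₁, δ (b ^ 2) = 0)
    (a : R) : δ ⟨a, hQT.le a.2⟩ ∈ Submodule.span (ResidueField R₁) {δ x₀'} := by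
  have hRO : R ≤ O.toSubring := hQT.source_le
  have hR₁O : R₁ ≤ O.toSubring := hQT.target_le
  have hval : ∀ a : R, a ∈ maximalIdeal R ↔ O.valuation (a : K) < 1 :=
    (subringDominates_valuationSubring_iff hRO).mp hdom
  have hvx₀ : O.valuation (x₀ : K) < 1 := (hval x₀).mp hx₀m
  have hx₀K : (x₀ : K) ≠ 0 := fun h => hx₀0 (Subtype.ext h)
  have hmax' : ∀ y ∈ R, O.valuation y < 1 → O.valuation y ≤ O.valuation (x₀ : K) :=
    fun y hy hvy => hx₀max ⟨y, hy⟩ ((hval ⟨y, hy⟩).mpr hvy)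
  obtain ⟨b, hb⟩ := hperf a
  set m : R := a - b ^ 2 with hm
  have hvm : O.valuation (m : K) < 1 := (hval m).mp hb
  have hmx : (m : K) / x₀ ∈ R₁ :=
    QuadraticStep.div_mem_of_isQuadraticTransformAlong hQT hdom x₀.2 hx₀K hvx₀ hmax' m.2 hvm
  -- `a = b ^ 2 + x₀' * (m / x₀)` in `R₁`
  have hres0 : residue R₁ x₀' = 0 := by
    rw [residue_eq_zero_iff]
    exact QuadraticStep.mem_maximalIdeal_of_valuation_lt_one hR₁O x₀' (by rw [hx₀']; exact hvx₀)
  have hdec : (⟨a, hQT.le a.2⟩ : R₁) = ⟨b, hQT.le b.2⟩ ^ 2 + x₀' * ⟨(m : K) / x₀, hmx⟩ := by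
    apply Subtype.ext
    show (a : K) = (b : K) ^ 2 + (x₀' : K) * ((m : K) / x₀)
    rw [hx₀', mul_div_cancel₀ _ hx₀K, hm]
    push_cast
    ring
  rw [hdec, hδadd, hδsq, zero_add, hδmul, hres0, zero_smul, zero_add]
  exact Submodule.smul_mem _ _ (Submodule.mem_span_singleton_self _)

/-- **The `δ`-classes of `x₀` and of the quotients `u_j / x₀` span the cotangent space of the quadratic
transform** (`u` lifts of a spanning family of `𝔪_R/𝔪_R²`): every element of `R₁ = (R[𝔪_R/x₀])_{𝔪_O}` is a
fraction of polynomials in the `m / x₀`, `m ∈ 𝔪_R`, with coefficients in `R`; `δ` of a coefficient is a multiple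
of `δx₀`, `m / x₀ = Σ c_j (u_j/x₀) + x₀ · (m₂/x₀²)`, Leibniz handles sums, products and fractions with unit
denominators, and `δ` restricted to `𝔪₁` is onto `𝔪₁/𝔪₁²`. [folklore] -/
theorem span_delta_eq_top [CharP K 2] {O : ValuationSubring K} {R R₁ : Subring K}
    [IsLocalRing R] [IsLocalRing R₁] (hQT : IsQuadraticTransformAlong O R R₁)
    (hdom : SubringDominates R O.toSubring)
    (hperf : ∀ a : R, ∃ b : R, a - b ^ 2 ∈ maximalIdeal R)
    (x₀ : R) (hx₀m : x₀ ∈ maximalIdeal R) (hx₀0 : x₀ ≠ 0)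
    (hx₀max : ∀ y ∈ maximalIdeal R, O.valuation (y : K) ≤ O.valuation (x₀ : K))
    (hR₁ : R₁ = locAtCentre (blowupRing R (x₀ : K)) O)
    (x₀' : R₁) (hx₀' : (x₀' : K) = x₀)
    {n : ℕ} (u : Fin n → maximalIdeal R)
    (hu : Submodule.span (ResidueField R)
      (Set.range fun j => (maximalIdeal R).toCotangent (u j)) = ⊤)
    (v : Fin n → R₁) (hv : ∀ j, (v j : K) = (u j : R) / x₀)
    (δ : R₁ → CotangentSpace R₁)
    (hδadd : ∀ a b : R₁, δ (a + b) = δ a + δ b)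
    (hδmul : ∀ a b : R₁, δ (a * b) = residue R₁ a • δ b + residue R₁ b • δ a)
    (hδmem : ∀ (m : R₁) (hm : m ∈ maximalIdeal R₁), δ m = (maximalIdeal R₁).toCotangent ⟨m, hm⟩)
    (hδsq : ∀ b : R₁, δ (b ^ 2) = 0) :
    Submodule.span (ResidueField R₁) (insert (δ x₀') (Set.range fun j => δ (v j))) = ⊤ := by
  classical
  have hRO : R ≤ O.toSubring := hQT.source_le
  have hR₁O : R₁ ≤ O.toSubring := hQT.target_le
  have hRR₁ : R ≤ R₁ := hQT.le
  have hval : ∀ a : R, a ∈ maximalIdeal R ↔ O.valuation (a : K) < 1 :=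
    (subringDominates_valuationSubring_iff hRO).mp hdom
  have hvx₀ : O.valuation (x₀ : K) < 1 := (hval x₀).mp hx₀m
  have hx₀K : (x₀ : K) ≠ 0 := fun h => hx₀0 (Subtype.ext h)
  have hres0 : residue R₁ x₀' = 0 := by
    rw [residue_eq_zero_iff]
    exact QuadraticStep.mem_maximalIdeal_of_valuation_lt_one hR₁O x₀' (by rw [hx₀']; exact hvx₀)
  have hB : blowupRing R (x₀ : K) ≤ R₁ := by rw [hR₁]; exact le_locAtCentre _ O
  set S : Submodule (ResidueField R₁) (CotangentSpace R₁) :=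
    Submodule.span (ResidueField R₁) (insert (δ x₀') (Set.range fun j => δ (v j))) with hS
  have hx₀'S : δ x₀' ∈ S := Submodule.subset_span (Set.mem_insert _ _)
  have hvS : ∀ j, δ (v j) ∈ S := fun j => Submodule.subset_span (Set.mem_insert_of_mem _ ⟨j, rfl⟩)
  have hlineS : Submodule.span (ResidueField R₁) {δ x₀'} ≤ S :=
    Submodule.span_mono (Set.singleton_subset_iff.mpr (Set.mem_insert _ _))
  have hδ0 : δ 0 = 0 := by simpa using hδsq 0
  have hδ1 : δ 1 = 0 := by simpa using hδsq 1
  -- (a) old elements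
  have hold : ∀ (a : K) (ha : a ∈ R), δ ⟨a, hRR₁ ha⟩ ∈ S := fun a ha =>
    hlineS (delta_inclusion_mem_span hQT hdom hperf x₀ hx₀m hx₀0 hx₀max x₀' hx₀' δ hδadd hδmul hδsq
      ⟨a, ha⟩)
  -- (b) quotients `m / x₀`, `m ∈ 𝔪_R`
  have hquot : ∀ (m : R), m ∈ maximalIdeal R → ∀ hm₁ : (m : K) / x₀ ∈ R₁, δ ⟨(m : K) / x₀, hm₁⟩ ∈ S := by
    intro m hm hm₁
    obtain ⟨c, hc, -⟩ := CotangentQuadratic.exists_coords u hu m hm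
    set m₂ : R := m - ∑ j, c j * (u j : R) with hm₂
    have hm₂x : (m₂ : K) / (x₀ : K) ^ 2 ∈ R₁ := hB (QuadraticStep.div_pow_mem_blowupRing x₀ hc)
    -- `m / x₀ = Σ c_j v_j + x₀' * (m₂ / x₀²)` in `R₁`
    have hdec : (⟨(m : K) / x₀, hm₁⟩ : R₁) =
        ∑ j, (⟨(c j : K), hRR₁ (c j).2⟩ : R₁) * v j + x₀' * ⟨(m₂ : K) / (x₀ : K) ^ 2, hm₂x⟩ := by
      apply Subtype.ext
      show (m : K) / x₀ = ((∑ j, (⟨(c j : K), hRR₁ (c j).2⟩ : R₁) * v j +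
        x₀' * ⟨(m₂ : K) / (x₀ : K) ^ 2, hm₂x⟩ : R₁) : K)
      push_cast
      simp only [hv, hx₀', hm₂]
      push_cast
      rw [div_eq_iff hx₀K, add_mul, Finset.sum_mul]
      have e1 : ∀ j, (c j : K) * ((u j : R) / (x₀ : K)) * x₀ = (c j : K) * (u j : R) := fun j => by
        field_simp
      simp only [e1]
      have e2 : (x₀ : K) * (((m : K) - ∑ j, (c j : K) * (u j : R)) / (x₀ : K) ^ 2) * x₀ =
          (m : K) - ∑ j, (c j : K) * (u j : R) := by
        field_simp
      rw [e2]
      ring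
    rw [hdec, hδadd]
    refine add_mem ?_ ?_
    · -- the sum
      have : δ (∑ j, (⟨(c j : K), hRR₁ (c j).2⟩ : R₁) * v j) =
          ∑ j, δ ((⟨(c j : K), hRR₁ (c j).2⟩ : R₁) * v j) :=
        map_sum (AddMonoidHom.mk' δ hδadd) _ _
      rw [this]
      refine Submodule.sum_mem _ fun j _ => ?_
      rw [hδmul]
      exact add_mem (Submodule.smul_mem _ _ (hvS j)) (Submodule.smul_mem _ _ (hold _ (c j).2))
    · rw [hδmul, hres0, zero_smul, zero_add]
      exact Submodule.smul_mem _ _ hx₀'S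
  -- (c) the chart ring `R[𝔪/x₀]` by closure induction
  have hchart : ∀ (y : K) (hy : y ∈ blowupRing R (x₀ : K)), δ ⟨y, hB hy⟩ ∈ S := by
    intro y hy
    induction hy using Subring.closure_induction with
    | mem z hz =>
        rcases hz with hz | ⟨m, hm, rfl⟩
        · exact hold z hz
        · exact hquot m hm _
    | zero => rw [show (⟨0, _⟩ : R₁) = 0 from rfl, hδ0]; exact S.zero_mem
    | one => rw [show (⟨1, _⟩ : R₁) = 1 from rfl, hδ1]; exact S.zero_mem
    | add z w hz hw hz' hw' =>
        have : (⟨z + w, hB (add_mem hz hw)⟩ : R₁) = ⟨z, hB hz⟩ + ⟨w, hB hw⟩ := rfl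
        rw [this, hδadd]
        exact add_mem hz' hw'
    | neg z hz hz' =>
        have : (⟨-z, hB (neg_mem hz)⟩ : R₁) = ⟨z, hB hz⟩ := by
          apply Subtype.ext
          exact CharTwo.neg_eq z
        rw [this]
        exact hz'
    | mul z w hz hw hz' hw' =>
        have : (⟨z * w, hB (mul_mem hz hw)⟩ : R₁) = ⟨z, hB hz⟩ * ⟨w, hB hw⟩ := rfl
        rw [this, hδmul]
        exact add_mem (Submodule.smul_mem _ _ hw') (Submodule.smul_mem _ _ hz')
  -- (d) fractions with unit denominators
  have hall : ∀ y : R₁, δ y ∈ S := by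
    intro y
    have hy : (y : K) ∈ locAtCentre (blowupRing R (x₀ : K)) O := by rw [← hR₁]; exact y.2
    obtain ⟨a, ha, b, hb, hvb, hab⟩ := mem_locAtCentre_iff.mp hy
    have hbK : b ≠ 0 := ne_zero_of_valuation_eq_one hvb
    set a' : R₁ := ⟨a, hB ha⟩
    set b' : R₁ := ⟨b, hB hb⟩
    have hyb : y * b' = a' := by
      apply Subtype.ext
      show (y : K) * b = a
      rw [hab, div_mul_cancel₀ _ hbK]
    have hbinv : b⁻¹ ∈ R₁ := by
      rw [hR₁]; exact inv_mem_locAtCentre (le_locAtCentre _ O hb) hvb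
    have hbu : IsUnit b' := (isUnit_subring_iff_inv_mem b').mpr ⟨hbK, hbinv⟩
    have hres : residue R₁ b' ≠ 0 := (hbu.map (residue R₁)).ne_zero
    have key : residue R₁ b' • δ y = δ a' - residue R₁ y • δ b' := by
      rw [eq_sub_iff_add_eq, add_comm, ← hδmul, hyb]
    have : δ y = (residue R₁ b')⁻¹ • (residue R₁ b' • δ y) := by
      rw [smul_smul, inv_mul_cancel₀ hres, one_smul]
    rw [this, key]
    exact Submodule.smul_mem _ _ (sub_mem (hchart a ha) (Submodule.smul_mem _ _ (hchart b hb)))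
  -- (e) `δ` restricted to `𝔪₁` is onto the cotangent space
  rw [eq_top_iff]
  rintro w -
  obtain ⟨m, rfl⟩ := (maximalIdeal R₁).toCotangent_surjective w
  rw [← hδmem m m.2]
  exact hall m

end Summit.ResolutionOfSingularities.ResolutionOfSingularities.Theorems.SwitchingDichotomy.RankFourExit

end
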